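import Literature.Barriers.ABC.EpsilonCannotBeDroppedHolds
import HarnessLib

/-!
# Lower bound for the number of abc hits (abc.S28): `N(X) ≥ exp((log X)^{1/2 − ε})`, proved

Companion ("Proofs") file of `AbcWave0.lean`; no new definitions, no named facts. It DISCHARGES
the abc.S28 named fact `Literature.NumberTheory.DiophantineGeometry.abcHitCount_lower_bound`
(S. R. Dahmen, *Lower bounds for numbers of ABC-hits*, J. Number Theory **128** (2008) 1864–1873,
Theorem 1): writing `N(X)` for the number of abc hits (`a + b = c ≤ X` coprime, `rad(abc) < c`),
for every `ε > 0` one has `N(X) ≥ exp((log X)^{1/2 − ε})` for all large `X`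
(`abcHitCount_lower_bound_holds`).

## Proof

The Erdős–Stewart–Tijdeman smooth-number construction (Stewart–Tijdeman 1986; Bombieri–Gubler,
*Heights in Diophantine Geometry* (2006), 12.4.8–12.4.10), counted instead of optimised:

* (`Dahmen.div_gcd_spec`, `Dahmen.card_le_abcHitCount_succ`) if `n₀ < n'` are `P`-units (all prime
  factors in the finite set of primes `P`) congruent modulo `m`, no prime of `P` divides `m`, and
  `(∏_{p ∈ P} p) · rad(m) < m`, then with `g = gcd(n₀, n')` the triple
  `(n₀/g, (n' − n₀)/g, n'/g)` is an abc hit with `c ≤ n'` (`rad(ac) ∣ ∏ P`, `m ∣ b`, so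
  `rad(abc) · m ≤ (∏ P) rad(m) b < m b`); for fixed `n₀` these hits are distinct, so a set of `T`
  pairwise congruent `P`-units `≤ X` gives `N(X) ≥ T − 1`;
* (`Dahmen.smooth_bound_lt_abcHitCount`) with `P` the primes `≤ t`, `q` a prime in `(t, 2t]`
  (Bertrand), `Q = ∏_{p ≤ t} p < q^{e+1}` (`e = log_q Q`) and `m = q^{e+2} ≤ 4t² Q`, Dirichlet's
  pigeonhole on the `P`-units `≤ X` — at least `(log X)^{π(t)} / (π(t)! ∏_{p≤t} log p)` of them
  (Bombieri–Gubler Prop. 12.4.8, `Literature.Barriers.ABC.StewartTijdeman.exists_smooth_finset`) —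
  gives `N(X) + 2 > (log X)^{π(t)} / (π(t)! ∏ log p · 4t² Q)`;
* (`Dahmen.log_smooth_bound_ge`) by Stirling and `π(t) ≤ t`, `log p ≤ log t`, the logarithm of the
  right-hand side is `≥ π(t)(log log X − 2 log t − log log t + 1) − 2.5 log t − 1 − log 4`;
* (`abcHitCount_lower_bound_holds`) with `t = ⌊y⌋`, `y = (log X)^A`, `A = 1/2 − ε/2`, and the
  Chebyshev-strength lower bound `π(y) ≥ y / (2 log y)` (from the prime number theorem proved in
  `Literature.NumberTheory.LFunctions.RHWave0PNTProofs`, via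
  `Literature.Barriers.ABC.StewartTijdeman.eventually_primeCounting_bounds`) this is
  `≥ (ε/(2(1−ε))) y − O(log y) ≥ y^κ + log 4`, `κ = (1 − 2ε)/(1 − ε) < 1`, for large `y`, and
  `y^κ = (log X)^{1/2 − ε}`; the case `ε > 1/4` follows from `ε = 1/4` by monotonicity.

Only the statement of Dahmen's Theorem 1 is taken from the source ("for every `ε > 0` and `X`
large enough `N(X) ≥ exp((log X)^{1/2−ε})`", abstract; the paper is paywalled and not held, the
statement was checked against the review Zbl 1139.11022, which records it as
`N(X) ≫ exp((log X)^{1/2−ε})` for every `ε > 0` — the same assertion, the implied constant being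
absorbed by shrinking `ε`); the proof written here is the pigeonhole argument above and is not
claimed to be the paper's. Dahmen counts hits; `abcHitCount` counts ordered triples `(a, b, c)`,
which can only be larger, so the discharged inequality is implied by (and here proved
independently of) the printed one.

## References

* S. R. Dahmen, *Lower bounds for numbers of ABC-hits*, J. Number Theory 128 (2008), 1864–1873,
  Theorem 1. [Dahmen2008]
* E. Bombieri, W. Gubler, *Heights in Diophantine Geometry*, CUP 2006, Prop. 12.4.8, 12.4.10.
  [BombieriGubler2006]
* C. L. Stewart, R. Tijdeman, *On the Oesterlé–Masser conjecture*, Monatsh. Math. 102 (1986)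
  251–257. [StewartTijdeman1986]
-/

noncomputable section

open UniqueFactorizationMonoid Finset Filter
open Literature.Barriers.ABC.StewartTijdeman (exists_smooth_finset log_factorial_le
  eventually_primeCounting_bounds)

namespace Literature.NumberTheory.DiophantineGeometry

namespace Dahmen

/-! ### The gcd step, explicitly, and the count of hits in one residue class -/

/-- **The gcd step (Bombieri–Gubler 12.4.10), with the triple made explicit.** If `0 < n < n'` are
congruent modulo `m`, all prime factors of `n n'` lie in a set `P` of primes none of which divides
`m`, then with `g = gcd(n, n')` the triple `a = n/g`, `b = n'/g − n/g`, `c = n'/g` is an abc triple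
with `m ∣ b` and `rad(abc) · m ≤ (∏_{p∈P} p) · rad(m) · b`. (Same proof as
`Literature.Barriers.ABC.StewartTijdeman.exists_triple_of_modEq`, which only asserts existence.)
[cite: BombieriGubler2006, 12.4.10] -/
theorem div_gcd_spec {P : Finset ℕ} (hP : ∀ p ∈ P, p.Prime) {m n n' : ℕ} (hm : 0 < m)
    (hn0 : 0 < n) (hlt : n < n') (hmod : n ≡ n' [MOD m]) (hn : n.primeFactors ⊆ P)
    (hn' : n'.primeFactors ⊆ P) (hPm : ∀ p ∈ P, ¬ p ∣ m) :
    IsABCTriple (n / n.gcd n') (n' / n.gcd n' - n / n.gcd n') (n' / n.gcd n') ∧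
      m ∣ n' / n.gcd n' - n / n.gcd n' ∧
      rad (n / n.gcd n') (n' / n.gcd n' - n / n.gcd n') (n' / n.gcd n') * m ≤
        (∏ p ∈ P, p) * radical m * (n' / n.gcd n' - n / n.gcd n') := by
  have hn'0 : 0 < n' := lt_trans hn0 hlt
  set d := n.gcd n' with hd
  have hd0 : 0 < d := Nat.gcd_pos_of_pos_left _ hn0
  have hdn : d ∣ n := Nat.gcd_dvd_left _ _
  have hdn' : d ∣ n' := Nat.gcd_dvd_right _ _
  set a := n / d with ha
  set c := n' / d with hc
  have hda : d * a = n := Nat.mul_div_cancel' hdn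
  have hdc : d * c = n' := Nat.mul_div_cancel' hdn'
  have ha0 : 0 < a := Nat.div_pos (Nat.le_of_dvd hn0 hdn) hd0
  have hac : a < c := Nat.div_lt_div_of_lt_of_dvd hdn' hlt
  have hcop : Nat.Coprime a c := Nat.coprime_div_gcd_div_gcd hd0
  set b := c - a with hb
  have hb0 : 0 < b := by omega
  have habc : a + b = c := by omega
  have hcopab : Nat.Coprime a b := (Nat.coprime_sub_self_right hac.le).mpr hcop
  -- `m ∣ b`
  have hdvd_sub : m ∣ n' - n := (Nat.modEq_iff_dvd' hlt.le).mp hmod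
  have hsub : n' - n = d * b := by rw [hb, Nat.mul_sub, hdc, hda]
  have hcopmd : Nat.Coprime m d := by
    refine Nat.coprime_of_dvd fun q hq hqm hqd => ?_
    have hqn : q ∣ n := dvd_trans hqd hdn
    exact hPm q (hn (Nat.mem_primeFactors.mpr ⟨hq, hqn, hn0.ne'⟩)) hqm
  have hmb : m ∣ b := by
    rw [hsub] at hdvd_sub
    exact hcopmd.dvd_of_dvd_mul_left hdvd_sub
  obtain ⟨b', hb'⟩ := hmb
  have hb'0 : 0 < b' := by
    rcases Nat.eq_zero_or_pos b' with h | h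
    · rw [h, mul_zero] at hb'; omega
    · exact h
  -- every prime factor of `abc` divides `K = (∏ P) * rad m * b'`
  have hprod0 : (∏ p ∈ P, p) ≠ 0 := prod_ne_zero_iff.mpr fun p hp => (hP p hp).ne_zero
  set K : ℕ := (∏ p ∈ P, p) * radical m * b' with hK
  have hK0 : K ≠ 0 := Nat.mul_ne_zero (Nat.mul_ne_zero hprod0 radical_ne_zero) hb'0.ne'
  have ha_dvd : a ∣ n := ⟨d, by rw [mul_comm, hda]⟩
  have hc_dvd : c ∣ n' := ⟨d, by rw [mul_comm, hdc]⟩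
  have hPdvd : ∀ q, q ∈ P → q ∣ ∏ p ∈ P, p := fun q hq => dvd_prod_of_mem _ hq
  have hrad_dvd : radical (a * b * c) ∣ K := by
    rw [Nat.radical_dvd_iff hK0]
    intro q hq
    rw [Nat.mem_primeFactors] at hq ⊢
    obtain ⟨hqprime, hqdvd, -⟩ := hq
    refine ⟨hqprime, ?_, hK0⟩
    rcases (Nat.Prime.dvd_mul hqprime).mp hqdvd with h | h
    · rcases (Nat.Prime.dvd_mul hqprime).mp h with h' | h'
      · -- `q ∣ a ∣ n`
        have hqP : q ∈ P := hn (Nat.mem_primeFactors.mpr ⟨hqprime, dvd_trans h' ha_dvd, hn0.ne'⟩)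
        exact dvd_mul_of_dvd_left (dvd_mul_of_dvd_left (hPdvd q hqP) _) _
      · -- `q ∣ b = m * b'`
        rw [hb'] at h'
        rcases (Nat.Prime.dvd_mul hqprime).mp h' with h'' | h''
        · have hqrad : q ∣ radical m := by
            rw [Nat.radical_eq_prod_primeFactors]
            exact dvd_prod_of_mem _ (Nat.mem_primeFactors.mpr ⟨hqprime, h'', hm.ne'⟩)
          exact dvd_mul_of_dvd_left (dvd_mul_of_dvd_right hqrad _) _
        · exact dvd_mul_of_dvd_right h'' _
    · have hqP : q ∈ P := hn' (Nat.mem_primeFactors.mpr ⟨hqprime, dvd_trans h hc_dvd, hn'0.ne'⟩)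
      exact dvd_mul_of_dvd_left (dvd_mul_of_dvd_left (hPdvd q hqP) _) _
  have hrad_le : radical (a * b * c) ≤ K := Nat.le_of_dvd (Nat.pos_of_ne_zero hK0) hrad_dvd
  refine ⟨⟨ha0, hb0, habc, hcopab⟩, ⟨b', hb'⟩, ?_⟩
  calc rad a b c * m = radical (a * b * c) * m := rfl
    _ ≤ K * m := Nat.mul_le_mul_right _ hrad_le
    _ = (∏ p ∈ P, p) * radical m * b := by rw [hK, hb']; ring

/-- **Hits from one residue class.** Let `P` be a finite set of primes, `m > 0` divisible by no
prime of `P` with `(∏_{p∈P} p) · rad(m) < m`, and `T` a set of positive `P`-units `≤ X`, pairwise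
congruent modulo `m`. Then `N(X) ≥ |T| − 1`: with `n₀ = min T`, the gcd step applied to
`(n₀, n')`, `n' ∈ T ∖ {n₀}`, yields abc triples with `c ≤ n' ≤ X` and
`rad(abc) · m ≤ (∏ P) rad(m) b < m b`, i.e. `rad(abc) < b < c`; they are pairwise distinct since
`n₀ / gcd(n₀, n')` determines the gcd and then `n' / gcd` determines `n'`.
[cite: Dahmen2008, Theorem 1 (proof)] -/
theorem card_le_abcHitCount_succ {P : Finset ℕ} (hP : ∀ p ∈ P, p.Prime) {m : ℕ} (hm : 0 < m)
    (hPm : ∀ p ∈ P, ¬ p ∣ m) (hQm : (∏ p ∈ P, p) * radical m < m) {X : ℕ} {T : Finset ℕ}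
    (hT : ∀ s ∈ T, 0 < s ∧ s ≤ X ∧ s.primeFactors ⊆ P)
    (hmod : ∀ s ∈ T, ∀ s' ∈ T, s ≡ s' [MOD m]) :
    T.card ≤ abcHitCount X + 1 := by
  classical
  rcases T.eq_empty_or_nonempty with rfl | hne
  · simp
  set n₀ := T.min' hne with hn₀
  have hn₀T : n₀ ∈ T := min'_mem T hne
  have hn₀0 : 0 < n₀ := (hT n₀ hn₀T).1
  set H : Set (ℕ × ℕ × ℕ) :=
    {t : ℕ × ℕ × ℕ | IsABCTriple t.1 t.2.1 t.2.2 ∧ t.2.2 ≤ X ∧ rad t.1 t.2.1 t.2.2 < t.2.2} with hH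
  have hHfin : H.Finite := abcHits_finite X
  have hcount : abcHitCount X = hHfin.toFinset.card := Set.ncard_eq_toFinset_card H hHfin
  set f : ℕ → ℕ × ℕ × ℕ := fun n' =>
    (n₀ / n₀.gcd n', n' / n₀.gcd n' - n₀ / n₀.gcd n', n' / n₀.gcd n') with hf
  have hlt : ∀ n' ∈ T.erase n₀, n₀ < n' := fun n' hn' =>
    lt_of_le_of_ne (min'_le T n' (mem_of_mem_erase hn')) (Ne.symm (ne_of_mem_erase hn'))
  have hmaps : Set.MapsTo f (T.erase n₀ : Set ℕ) (hHfin.toFinset : Set (ℕ × ℕ × ℕ)) := by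
    intro n' hn'
    have hn'T : n' ∈ T := mem_of_mem_erase (mem_coe.mp hn')
    have hlt' : n₀ < n' := hlt n' (mem_coe.mp hn')
    obtain ⟨habc, -, hrad⟩ := div_gcd_spec hP hm hn₀0 hlt' (hmod n₀ hn₀T n' hn'T)
      (hT n₀ hn₀T).2.2 (hT n' hn'T).2.2 hPm
    rw [mem_coe, Set.Finite.mem_toFinset]
    refine ⟨habc, le_trans (Nat.div_le_self _ _) (hT n' hn'T).2.1, ?_⟩
    obtain ⟨ha0, hb0, hsum, -⟩ := habc
    have h1 : rad (n₀ / n₀.gcd n') (n' / n₀.gcd n' - n₀ / n₀.gcd n') (n' / n₀.gcd n') * m <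
        (n' / n₀.gcd n' - n₀ / n₀.gcd n') * m :=
      lt_of_le_of_lt hrad (by
        rw [mul_comm _ m]
        exact Nat.mul_lt_mul_of_pos_right hQm hb0)
    have h2 := Nat.lt_of_mul_lt_mul_right h1
    show rad (n₀ / n₀.gcd n') (n' / n₀.gcd n' - n₀ / n₀.gcd n') (n' / n₀.gcd n') < n' / n₀.gcd n'
    omega
  have hinj : Set.InjOn f (T.erase n₀ : Set ℕ) := by
    intro n₁ hn₁ n₂ hn₂ heq
    simp only [hf, Prod.mk.injEq] at heq
    obtain ⟨h1, -, h3⟩ := heq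
    have hg : n₀.gcd n₁ = n₀.gcd n₂ :=
      (Nat.div_eq_iff_eq_of_dvd_dvd hn₀0.ne' (Nat.gcd_dvd_left _ _) (Nat.gcd_dvd_left _ _)).mp h1
    rw [hg] at h3
    exact (Nat.div_left_inj (hg ▸ Nat.gcd_dvd_right n₀ n₁) (Nat.gcd_dvd_right n₀ n₂)).mp h3
  have hcard := card_le_card_of_injOn f hmaps hinj
  rw [card_erase_of_mem hn₀T, ← hcount] at hcard
  have : 1 ≤ T.card := card_pos.mpr hne
  omega

/-- **Dirichlet's pigeonhole.** Under the hypotheses of `card_le_abcHitCount_succ` on `P` and `m`,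
a set `S` of positive `P`-units `≤ X` has a residue class modulo `m` with at least `|S| / m`
elements, whence `|S| / m ≤ N(X) + 1`. [cite: BombieriGubler2006, 12.4.10] -/
theorem card_div_le_abcHitCount_succ {P : Finset ℕ} (hP : ∀ p ∈ P, p.Prime) {m : ℕ} (hm : 0 < m)
    (hPm : ∀ p ∈ P, ¬ p ∣ m) (hQm : (∏ p ∈ P, p) * radical m < m) {X : ℕ} {S : Finset ℕ}
    (hS : ∀ s ∈ S, 0 < s ∧ s ≤ X ∧ s.primeFactors ⊆ P) :
    S.card / m ≤ abcHitCount X + 1 := by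
  classical
  have hmaps : ∀ s ∈ S, s % m ∈ range m := fun s _ => mem_range.mpr (Nat.mod_lt _ hm)
  obtain ⟨r, -, hr⟩ := exists_le_card_fiber_of_mul_le_card_of_maps_to hmaps
    (nonempty_range_iff.mpr hm.ne') (by rw [card_range]; exact Nat.mul_div_le _ _)
  refine hr.trans (card_le_abcHitCount_succ hP hm hPm hQm (fun s hs => hS s (mem_filter.mp hs).1)
    fun s hs s' hs' => ?_)
  exact ((mem_filter.mp hs).2.trans (mem_filter.mp hs').2.symm :)

/-! ### The construction with all primes `≤ t` and a Bertrand prime power as modulus -/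

/-- **The smooth-number bound for `N(X)`.** For `t ≥ 1` and `X ≥ 1`,
`(log X)^{π(t)} / (π(t)! ∏_{p ≤ t} log p) / (4 t² ∏_{p ≤ t} p) < N(X) + 2`: the `P`-units `≤ X`
for `P` the primes `≤ t` number at least the numerator (Bombieri–Gubler Prop. 12.4.8); take a prime
`t < q ≤ 2t` (Bertrand), `Q = ∏_{p≤t} p`, `e = ⌊log_q Q⌋`, `m = q^{e+2}`, so that `Q · rad(m) =
Q q < q^{e+1} q = m ≤ q² Q ≤ 4t² Q`, and apply the pigeonhole count.
[cite: Dahmen2008, Theorem 1 (proof)] -/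
theorem smooth_bound_lt_abcHitCount {t : ℕ} (ht : t ≠ 0) {X : ℕ} (hX : 1 ≤ X) :
    Real.log X ^ (Nat.primesLE t).card /
        (((Nat.primesLE t).card.factorial : ℝ) * ∏ p ∈ Nat.primesLE t, Real.log p) /
        (4 * (t : ℝ) ^ 2 * ((∏ p ∈ Nat.primesLE t, p : ℕ) : ℝ)) < abcHitCount X + 2 := by
  set P := Nat.primesLE t with hPdef
  have hPprime : ∀ p ∈ P, p.Prime := fun p hp => (Nat.mem_primesLE.mp hp).2
  have hPle : ∀ p ∈ P, p ≤ t := fun p hp => (Nat.mem_primesLE.mp hp).1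
  -- the `P`-units up to `X`
  obtain ⟨S, hSmem, hSbound⟩ := exists_smooth_finset P hPprime (X : ℝ)
  have hX1 : (1 : ℝ) ≤ X := by exact_mod_cast hX
  have hB := hSbound hX1
  -- a Bertrand prime and the modulus
  obtain ⟨q, hq, htq, hq2t⟩ := Nat.exists_prime_lt_and_le_two_mul t ht
  set Q : ℕ := ∏ p ∈ P, p with hQdef
  have hQ0 : Q ≠ 0 := prod_ne_zero_iff.mpr fun p hp => (hPprime p hp).ne_zero
  set e := Nat.log q Q with he
  set m : ℕ := q ^ (e + 2) with hmdef
  have hm0 : 0 < m := pow_pos hq.pos _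
  have hPm : ∀ p ∈ P, ¬ p ∣ m := by
    intro p hp hdvd
    have hpq : p = q :=
      (Nat.prime_dvd_prime_iff_eq (hPprime p hp) hq).mp ((hPprime p hp).dvd_of_dvd_pow hdvd)
    have := hPle p hp
    omega
  have hradm : radical m = q := by
    rw [hmdef, radical_pow_of_prime hq.prime (by omega), normalize_eq]
  have hQlt : Q < q ^ (e + 1) := Nat.lt_pow_succ_log_self hq.one_lt Q
  have hQm : Q * radical m < m := by
    rw [hradm, hmdef, pow_succ]
    exact Nat.mul_lt_mul_of_pos_right hQlt hq.pos
  have hmle : m ≤ 4 * t ^ 2 * Q := by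
    have h1 : q ^ e ≤ Q := Nat.pow_log_le_self q hQ0
    have h2 : q ^ 2 ≤ (2 * t) ^ 2 := Nat.pow_le_pow_left hq2t 2
    calc m = q ^ 2 * q ^ e := by rw [hmdef]; ring
      _ ≤ (2 * t) ^ 2 * Q := Nat.mul_le_mul h2 h1
      _ = 4 * t ^ 2 * Q := by ring
  -- counting
  have hS' : ∀ s ∈ S, 0 < s ∧ s ≤ X ∧ s.primeFactors ⊆ P := fun s hs =>
    ⟨(hSmem s hs).1, by exact_mod_cast (hSmem s hs).2.1, (hSmem s hs).2.2⟩
  have hcount : S.card / (4 * t ^ 2 * Q) ≤ abcHitCount X + 1 :=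
    le_trans (Nat.div_le_div_left hmle hm0) (card_div_le_abcHitCount_succ hPprime hm0 hPm hQm hS')
  -- to `ℝ`
  have hD0 : 0 < 4 * t ^ 2 * Q := by positivity
  have hlt : S.card < (4 * t ^ 2 * Q) * (S.card / (4 * t ^ 2 * Q) + 1) := Nat.lt_mul_div_succ _ hD0
  have hltR : (S.card : ℝ) < (4 * (t : ℝ) ^ 2 * (Q : ℝ)) * ((S.card / (4 * t ^ 2 * Q) : ℕ) + 1) := by
    exact_mod_cast hlt
  have hD0R : (0 : ℝ) < 4 * (t : ℝ) ^ 2 * (Q : ℝ) := by exact_mod_cast hD0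
  have hcountR : ((S.card / (4 * t ^ 2 * Q) : ℕ) : ℝ) ≤ abcHitCount X + 1 := by exact_mod_cast hcount
  calc Real.log X ^ P.card / ((P.card.factorial : ℝ) * ∏ p ∈ P, Real.log p) /
        (4 * (t : ℝ) ^ 2 * (Q : ℝ))
      ≤ (S.card : ℝ) / (4 * (t : ℝ) ^ 2 * (Q : ℝ)) := div_le_div_of_nonneg_right hB hD0R.le
    _ < (S.card / (4 * t ^ 2 * Q) : ℕ) + 1 := by rw [div_lt_iff₀' hD0R]; exact hltR
    _ ≤ abcHitCount X + 1 + 1 := by linarith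
    _ = abcHitCount X + 2 := by ring

/-- `π(t) ≤ t` (no prime is `0`; crude, all that is needed). [folklore] -/
theorem card_primesLE_le (t : ℕ) : (Nat.primesLE t).card ≤ t := by
  calc (Nat.primesLE t).card ≤ (Icc 1 t).card := by
        refine card_le_card fun p hp => ?_
        obtain ⟨hpt, hp⟩ := Nat.mem_primesLE.mp hp
        exact mem_Icc.mpr ⟨hp.one_le, hpt⟩
    _ = t := by rw [Nat.card_Icc]; omega

/-- **The logarithm of the smooth-number bound.** For `t ≥ 2` and `X ≥ 2`, with `n = π(t)`,
`L = log t`, `ℓ = log log X`: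
`n (ℓ − 2L − log L + 1) − 2.5 L − 1 − log 4 ≤ log [(log X)^n / (n! ∏_{p≤t} log p) / (4t² ∏_{p≤t} p)]`
(Stirling `log n! ≤ n log n − n + ½ log n + 1`, `log n ≤ L`, `log log p ≤ log L`, `log p ≤ L`).
[cite: Dahmen2008, Theorem 1 (proof)] -/
theorem log_smooth_bound_ge {t : ℕ} (ht : 2 ≤ t) {X : ℕ} (hX : 2 ≤ X) :
    ((Nat.primesLE t).card : ℝ) *
          (Real.log (Real.log X) - 2 * Real.log t - Real.log (Real.log t) + 1) -
        5 / 2 * Real.log t - 1 - Real.log 4 ≤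
      Real.log (Real.log X ^ (Nat.primesLE t).card /
        (((Nat.primesLE t).card.factorial : ℝ) * ∏ p ∈ Nat.primesLE t, Real.log p) /
        (4 * (t : ℝ) ^ 2 * ((∏ p ∈ Nat.primesLE t, p : ℕ) : ℝ))) := by
  set P := Nat.primesLE t with hPdef
  have hPprime : ∀ p ∈ P, p.Prime := fun p hp => (Nat.mem_primesLE.mp hp).2
  have hPle : ∀ p ∈ P, p ≤ t := fun p hp => (Nat.mem_primesLE.mp hp).1
  set n := P.card with hndef
  set L := Real.log t with hLdef
  have ht0 : (0 : ℝ) < t := by exact_mod_cast (by omega : 0 < t)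
  have ht2 : (2 : ℝ) ≤ t := by exact_mod_cast ht
  have hL0 : 0 < L := Real.log_pos (by linarith)
  have hX0 : (0 : ℝ) < Real.log X := Real.log_pos (by exact_mod_cast (by omega : 1 < X))
  have h2P : 2 ∈ P := Nat.mem_primesLE.mpr ⟨ht, Nat.prime_two⟩
  have hn1 : 1 ≤ n := card_pos.mpr ⟨2, h2P⟩
  have hn1R : (1 : ℝ) ≤ n := by exact_mod_cast hn1
  have hn0R : (0 : ℝ) < n := by linarith
  have hnt : n ≤ t := card_primesLE_le t
  have hlogn : Real.log n ≤ L := Real.log_le_log hn0R (by exact_mod_cast hnt)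
  have hlogn0 : 0 ≤ Real.log n := Real.log_nonneg hn1R
  have hlogp : ∀ p ∈ P, 0 < Real.log (p : ℝ) := fun p hp =>
    Real.log_pos (by exact_mod_cast (hPprime p hp).one_lt)
  have hlogp_le : ∀ p ∈ P, Real.log (p : ℝ) ≤ L := fun p hp =>
    Real.log_le_log (by exact_mod_cast (hPprime p hp).pos) (by exact_mod_cast hPle p hp)
  set Pl : ℝ := ∏ p ∈ P, Real.log p with hPl
  have hPl0 : 0 < Pl := prod_pos hlogp
  set Q : ℕ := ∏ p ∈ P, p with hQdef
  have hQ0R : (0 : ℝ) < Q := by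
    rw [hQdef]; exact_mod_cast prod_pos fun p hp => (hPprime p hp).pos
  have hfact0 : (0 : ℝ) < n.factorial := by exact_mod_cast Nat.factorial_pos n
  -- expand the logarithm
  have hlogB : Real.log (Real.log X ^ n / ((n.factorial : ℝ) * Pl) / (4 * (t : ℝ) ^ 2 * Q)) =
      n * Real.log (Real.log X) - Real.log (n.factorial : ℝ) - ∑ p ∈ P, Real.log (Real.log p) -
        (Real.log 4 + 2 * L + ∑ p ∈ P, Real.log p) := by
    rw [Real.log_div (by positivity) (by positivity), Real.log_div (by positivity) (by positivity),
      Real.log_mul (by positivity) hPl0.ne', Real.log_pow, hPl,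
      Real.log_prod (fun p hp => (hlogp p hp).ne'), Real.log_mul (by positivity) hQ0R.ne',
      Real.log_mul (by norm_num) (by positivity), Real.log_pow, hQdef, Nat.cast_prod,
      Real.log_prod (fun p hp => ?_)]
    · push_cast; ring
    · exact_mod_cast (hPprime p hp).ne_zero
  have hSt : Real.log (n.factorial : ℝ) ≤ n * Real.log n - n + Real.log n / 2 + 1 :=
    log_factorial_le hn1
  have hsum1 : ∑ p ∈ P, Real.log (Real.log (p : ℝ)) ≤ n * Real.log L := by
    calc ∑ p ∈ P, Real.log (Real.log (p : ℝ)) ≤ ∑ p ∈ P, Real.log L :=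
          sum_le_sum fun p hp => Real.log_le_log (hlogp p hp) (hlogp_le p hp)
      _ = n * Real.log L := by rw [sum_const, nsmul_eq_mul, hndef]
  have hsum2 : ∑ p ∈ P, Real.log (p : ℝ) ≤ n * L := by
    calc ∑ p ∈ P, Real.log (p : ℝ) ≤ ∑ p ∈ P, L := sum_le_sum fun p hp => hlogp_le p hp
      _ = n * L := by rw [sum_const, nsmul_eq_mul, hndef]
  have hnlogn : (n : ℝ) * Real.log n ≤ n * L := mul_le_mul_of_nonneg_left hlogn hn0R.le
  rw [hlogB]
  nlinarith [hSt, hsum1, hsum2, hnlogn, hlogn, hlogn0, hL0]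

end Dahmen

/-! ### The discharge -/

/-- The main estimate for `0 < ε ≤ 1/4`: eventually `exp((log X)^{1/2 − ε}) ≤ N(X)`, with
`t = ⌊y⌋`, `y = (log X)^{1/2 − ε/2}` in `Dahmen.smooth_bound_lt_abcHitCount`, the prime number
theorem in the weak form `π(y) ≥ y / (2 log y)`, and `Dahmen.log_smooth_bound_ge`.
[cite: Dahmen2008, Theorem 1] -/
theorem Dahmen.eventually_exp_rpow_le_abcHitCount {ε : ℝ} (hε : 0 < ε) (hε4 : ε ≤ 1 / 4) :
    ∀ᶠ X : ℕ in atTop, Real.exp (Real.log X ^ (1 / 2 - ε : ℝ)) ≤ abcHitCount X := by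
  -- constants
  set A : ℝ := 1 / 2 - ε / 2 with hA
  have hA0 : 0 < A := by rw [hA]; linarith
  have hA1 : A < 1 / 2 := by rw [hA]; linarith
  set c : ℝ := ε / (1 - ε) with hc
  have hε1 : 0 < 1 - ε := by linarith
  have hc0 : 0 < c := div_pos hε hε1
  have hcA : 1 / A - 2 = 2 * c := by
    rw [hA, hc]; field_simp; ring
  set κ : ℝ := (1 / 2 - ε) / A with hκ
  have hκA : A * κ = 1 / 2 - ε := by rw [hκ]; field_simp
  have hκ1 : κ - 1 = -c := by rw [hκ, hA, hc]; field_simp; ring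
  -- eventual facts in the real parameter `y`
  have hE1 := eventually_primeCounting_bounds (ε := 1 / 2) (by norm_num)
  have hE2 : ∀ᶠ y : ℝ in atTop, Real.log (Real.log y) ≤ c * Real.log y := by
    have h := (Real.isLittleO_log_id_atTop.comp_tendsto Real.tendsto_log_atTop).bound hc0
    filter_upwards [h, Real.tendsto_log_atTop.eventually_ge_atTop 1] with y hy hy1
    simp only [Function.comp, id, Real.norm_eq_abs] at hy
    rw [abs_of_nonneg (by linarith : (0 : ℝ) ≤ Real.log y)] at hy
    exact (le_abs_self _).trans hy
  have hE3 : ∀ᶠ y : ℝ in atTop, y ^ κ ≤ c / 6 * y := by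
    have h := (tendsto_rpow_neg_atTop hc0).eventually_le_const (div_pos hc0 (by norm_num) : 0 < c / 6)
    filter_upwards [h, eventually_gt_atTop 0] with y hy hy0
    have : y ^ κ = y ^ (-c) * y := by
      rw [← hκ1, ← Real.rpow_add_one hy0.ne' (κ - 1)]; ring_nf
    rw [this]
    exact mul_le_mul_of_nonneg_right hy hy0.le
  have hE4 : ∀ᶠ y : ℝ in atTop, Real.log y ≤ c / 15 * y := by
    have h := Real.isLittleO_log_id_atTop.bound (div_pos hc0 (by norm_num) : 0 < c / 15)
    filter_upwards [h, eventually_ge_atTop 0] with y hy hy0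
    simp only [id, Real.norm_eq_abs, abs_of_nonneg hy0] at hy
    exact (le_abs_self _).trans hy
  have hev := hE1.and (hE2.and (hE3.and (hE4.and
    ((eventually_ge_atTop (30 / c)).and (eventually_ge_atTop (Real.exp (Real.exp 1)))))))
  obtain ⟨y₁, hy₁⟩ := Filter.eventually_atTop.mp hev
  -- `y = (log X)^A → ∞`
  have hylim : Tendsto (fun X : ℕ => Real.log X ^ A) atTop atTop :=
    (tendsto_rpow_atTop hA0).comp (Real.tendsto_log_atTop.comp tendsto_natCast_atTop_atTop)
  filter_upwards [hylim.eventually_ge_atTop y₁, eventually_ge_atTop 3] with X hXy hX3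
  -- notation
  set y : ℝ := Real.log X ^ A with hydef
  obtain ⟨⟨hπ, -⟩, hll, hyκ, hlogy, hy30, hyee⟩ := hy₁ y hXy
  set t : ℕ := ⌊y⌋₊ with htdef
  have hX3R : (3 : ℝ) ≤ X := by exact_mod_cast hX3
  have hlogX1 : 1 < Real.log X := by
    rw [← Real.log_exp 1]
    refine Real.log_lt_log (Real.exp_pos 1) (lt_of_lt_of_le ?_ hX3R)
    have := Real.exp_one_lt_d9; norm_num at this ⊢; linarith
  have hlogX0 : 0 < Real.log X := by linarith
  have hee : Real.exp 1 < Real.exp (Real.exp 1) := Real.exp_lt_exp.mpr (by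
    have := Real.add_one_le_exp (1 : ℝ); linarith)
  have hy0 : 0 < y := lt_of_lt_of_le (Real.exp_pos _) hyee
  have hye : Real.exp 1 ≤ y := le_trans hee.le hyee
  set Λ : ℝ := Real.log y with hΛdef
  have hΛ1 : 1 ≤ Λ := by
    rw [hΛdef, ← Real.log_exp 1]; exact Real.log_le_log (Real.exp_pos 1) hye
  have hΛ0 : 0 < Λ := by linarith
  -- `t = ⌊y⌋ ≥ 2`, `log t ≤ Λ`
  have hy2 : (2 : ℝ) < y := by
    have := Real.exp_one_gt_d9; linarith
  have ht2 : 2 ≤ t := by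
    rw [htdef]; exact Nat.le_floor (by exact_mod_cast hy2.le)
  have ht0 : t ≠ 0 := by omega
  have htR0 : (0 : ℝ) < t := by exact_mod_cast (by omega : 0 < t)
  have hty : (t : ℝ) ≤ y := Nat.floor_le hy0.le
  have hLΛ : Real.log t ≤ Λ := Real.log_le_log htR0 hty
  have hL0 : 0 < Real.log t := Real.log_pos (by exact_mod_cast (by omega : 1 < t))
  have hlogLΛ : Real.log (Real.log t) ≤ Real.log Λ := Real.log_le_log hL0 hLΛ
  -- `ℓ = log log X = Λ / A`
  have hℓ : Real.log (Real.log X) = Λ / A := by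
    have : Real.log X = y ^ (1 / A) := by
      rw [hydef, one_div, Real.rpow_rpow_inv hlogX0.le hA0.ne']
    rw [this, Real.log_rpow hy0, hΛdef]; ring
  -- the two bounds
  have hX1 : 1 ≤ X := by omega
  have hX2 : 2 ≤ X := by omega
  have hlow := Dahmen.log_smooth_bound_ge ht2 hX2
  have hup := Dahmen.smooth_bound_lt_abcHitCount ht0 hX1
  set B : ℝ := Real.log X ^ (Nat.primesLE t).card /
        (((Nat.primesLE t).card.factorial : ℝ) * ∏ p ∈ Nat.primesLE t, Real.log p) /
        (4 * (t : ℝ) ^ 2 * ((∏ p ∈ Nat.primesLE t, p : ℕ) : ℝ)) with hBdef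
  set n : ℝ := ((Nat.primesLE t).card : ℝ) with hndef
  have hnπ : n = (Nat.primeCounting t : ℝ) := by
    rw [hndef, Nat.primesLE_card_eq_primeCounting]
  have hn_ge : y / (2 * Λ) ≤ n := by
    have h1 : (1 - 1 / 2 : ℝ) * (y / Λ) = y / (2 * Λ) := by ring
    rw [← h1, hnπ]
    exact hπ
  have hn0 : 0 ≤ n := by rw [hndef]; exact Nat.cast_nonneg _
  -- `log B ≥ n (ℓ - 2Λ - log Λ + 1) - 2.5 Λ - 3 ≥ c y / 2 - 2.5 Λ - 3`
  have hsplit : Λ / A = 2 * c * Λ + 2 * Λ := by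
    have h1 : Λ / A = Λ * (1 / A) := by ring
    have h2 : (1 : ℝ) / A = 2 * c + 2 := by linarith [hcA]
    rw [h1, h2]
    ring
  have hbr : c * Λ ≤ Real.log (Real.log X) - 2 * Real.log t - Real.log (Real.log t) + 1 := by
    rw [hℓ, hsplit]
    linarith [hll, hLΛ, hlogLΛ]
  have hlog4 : Real.log 4 < 2 := by
    have h4 : Real.log 4 = 2 * Real.log 2 := by
      rw [show (4 : ℝ) = 2 ^ 2 by norm_num, Real.log_pow]; push_cast; ring
    have := Real.log_two_lt_d9; linarith
  have hmain : c * y / 2 - 5 / 2 * Λ - 3 ≤ Real.log B := by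
    have h1 : n * (c * Λ) ≤ n * (Real.log (Real.log X) - 2 * Real.log t -
        Real.log (Real.log t) + 1) := mul_le_mul_of_nonneg_left hbr hn0
    have h2 : y / (2 * Λ) * (c * Λ) ≤ n * (c * Λ) :=
      mul_le_mul_of_nonneg_right hn_ge (by positivity)
    have h3 : y / (2 * Λ) * (c * Λ) = c * y / 2 := by
      rw [div_mul_eq_mul_div, show y * (c * Λ) = y * c * Λ by ring, mul_div_mul_right _ _ hΛ0.ne']
      ring
    have h4 : (5 : ℝ) / 2 * Real.log t ≤ 5 / 2 * Λ := by linarith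
    linarith [hlow, h1, h2, h3, h4, hlog4]
  -- `c y / 2 - 2.5 Λ - 3 ≥ y^κ + log 4`
  have hgoal : y ^ κ + Real.log 4 ≤ Real.log B := by
    have h30 : 30 ≤ c * y := by
      have := hy30; rwa [div_le_iff₀ hc0, mul_comm] at this
    linarith [hmain, hyκ, hlogy, h30, hlog4]
  -- conclude
  have hB4 : 4 * Real.exp (y ^ κ) ≤ B := by
    have hBpos : 0 < B := by
      rw [hBdef]
      have hX0 : (0 : ℝ) < Real.log X := hlogX0
      have : 0 < ∏ p ∈ Nat.primesLE t, Real.log (p : ℝ) :=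
        prod_pos fun p hp => Real.log_pos (by exact_mod_cast (Nat.mem_primesLE.mp hp).2.one_lt)
      have : (0 : ℝ) < ((∏ p ∈ Nat.primesLE t, p : ℕ) : ℝ) := by
        exact_mod_cast prod_pos fun p hp => (Nat.mem_primesLE.mp hp).2.pos
      positivity
    calc 4 * Real.exp (y ^ κ) = Real.exp (y ^ κ + Real.log 4) := by
          rw [Real.exp_add, Real.exp_log (by norm_num)]; ring
      _ ≤ Real.exp (Real.log B) := Real.exp_le_exp.mpr hgoal
      _ = B := Real.exp_log hBpos
  have hyκX : y ^ κ = Real.log X ^ (1 / 2 - ε : ℝ) := by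
    rw [hydef, ← Real.rpow_mul hlogX0.le, hκA]
  have hexp1 : 1 ≤ Real.exp (y ^ κ) := Real.one_le_exp (Real.rpow_nonneg hy0.le κ)
  rw [← hyκX]
  linarith [hB4, hup, hexp1]

/-- **Discharge of `Literature.NumberTheory.DiophantineGeometry.abcHitCount_lower_bound`**
(**abc.S28**; S. R. Dahmen, *Lower bounds for numbers of ABC-hits*, J. Number Theory 128 (2008),
Theorem 1): for every `ε > 0`, `N(X) ≥ exp((log X)^{1/2 − ε})` for all large `X`. For
`ε ≤ 1/4` this is `Dahmen.eventually_exp_rpow_le_abcHitCount`; for larger `ε` the bound for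
`ε = 1/4` is stronger once `log X ≥ 1`. [cite: Dahmen2008, Theorem 1] -/
theorem abcHitCount_lower_bound_holds : abcHitCount_lower_bound := by
  intro ε hε
  have h := Dahmen.eventually_exp_rpow_le_abcHitCount (ε := min ε (1 / 4))
    (lt_min hε (by norm_num)) (min_le_right _ _)
  filter_upwards [h, eventually_ge_atTop 3] with X hX hX3
  refine le_trans (Real.exp_le_exp.mpr ?_) hX
  have hX3R : (3 : ℝ) ≤ X := by exact_mod_cast hX3
  have hlogX1 : 1 ≤ Real.log X := by
    rw [← Real.log_exp 1]
    refine Real.log_le_log (Real.exp_pos 1) (le_trans ?_ hX3R)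
    have := Real.exp_one_lt_d9; norm_num at this ⊢; linarith
  exact Real.rpow_le_rpow_of_exponent_le hlogX1 (by linarith [min_le_left ε (1 / 4)])

end Literature.NumberTheory.DiophantineGeometry

end
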